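import Literature.NumberTheory.LFunctions.LevinsonConreyInequality
import Literature.NumberTheory.LFunctions.LevinsonLittlewoodStep
import Literature.NumberTheory.LFunctions.ZeroCountingProofs
import Literature.Analysis.Complex.ZeroAvoidance
import HarnessLib

/-!
# Levinson's method (Conrey's form), conditional on the mollified mean square:
# `κ ≥ 1 − (1/R) log c`

Topic `Literature/NumberTheory/LFunctions`. Everything here is PROVED; there are no definitions
and no named facts.

This file assembles the tree's formalisation of Levinson's method — the zero-detection
inequality `Literature.NumberTheory.LFunctions.levinsonConrey_inequality`
(`N₀(T₂) − N₀(T₁) ≥ N(T₂) − N(T₁) − 2N_V − O(log T₂)`), the Littlewood step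
`Literature.NumberTheory.LFunctions.levinson_littlewood_bound`
(`2π(½ − a)N_V ≤ ½U log(mean square of ψV) − U log(1−θ) + O(log T)`), the Riemann–von Mangoldt
formula and the liminf bookkeeping `Literature.NumberTheory.LFunctions.le_criticalLineProportion_of_dyadic`
— into the classical conditional statement (Levinson 1974; Conrey 1983, §4, "`κ ≥ 1 − R⁻¹ log c`";
Titchmarsh §10.28; Pratt–Robles–Zaharescu–Zeindler 2020, (1.9)–(1.10)):

**`levinson_criticalLineProportion_ge`.** Let `𝜙` be a real polynomial with `𝜙(x) + 𝜙(1−x) = c ≠ 0`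
and `𝜙(0) = 1`, let `R > 0`, and let `(ψ_T)` be a family of entire functions (the mollifiers) of
polynomial growth `‖ψ_T(z)‖ ≤ T^k` (`0 ≤ Re z`, `0 ≤ Im z ≤ 3T`) with `ψ_T → 1` on far-right
half-integer lines, uniformly for `t ∈ [T, 2T]`. If for every `ε > 0`, eventually in `T`,
`∫_T^{2T} |ψ_T V_T(a_T + it)|² dt ≤ (c_ms + ε) T` with `V_T = conreyV 𝜙 (log T)`,
`a_T = ½ − R/log T` and a constant `c_ms ≥ 1`, then
`κ = liminf N₀(T)/N(T) ≥ 1 − (log c_ms)/R`.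

So `przz_bound : 5/12 < κ` follows from this theorem, the mollified mean value theorem of PRZZ
(Thms 1.3/4.1/7.1: the asymptotic for the mean square with their `𝜙 = Q`, `ψ`, `R = 1.3036`) and
the numerical inequality `1 − (log c)/R > 5/12` (PRZZ §8) — via
`Literature.NumberTheory.LFunctions.lt_criticalLineProportion_of_eventually_mul_le`-type bookkeeping
already in the tree.

## References

* N. Levinson, *More than one third of zeros of Riemann's zeta-function are on `σ = 1/2`*,
  Adv. Math. 13 (1974), 383–436.
* J. B. Conrey, J. Number Theory 16 (1983), 49–74, §4. [Conrey1983]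
* E. C. Titchmarsh, *The Theory of the Riemann Zeta-Function*, 2nd ed. (1986), §10.28.
  [Titchmarsh1986]
* K. Pratt, N. Robles, A. Zaharescu, D. Zeindler, Res. Math. Sci. 7 (2020), §1.3 (1.9)–(1.10).
  [PrattRoblesZaharescuZeindler2020]
-/

noncomputable section

open Complex Polynomial Set Filter Topology Metric MeasureTheory intervalIntegral Asymptotics
open scoped Real ComplexConjugate

namespace Literature.NumberTheory.LFunctions

open Literature.Analysis.Complex SiegelIntegral

/-! ### Counting consequences of the Riemann–von Mangoldt formula -/

/-- **Local bound**: `N(T+1) − N(T) ≤ C log T` for `T ≥ T₀`. [cite: Titchmarsh1986, Thm. 9.2] -/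
theorem exists_zetaZeroCount_add_one_sub_le :
    ∃ C T₀ : ℝ, 0 < C ∧ 2 ≤ T₀ ∧ ∀ T : ℝ, T₀ ≤ T →
      (zetaZeroCount (T + 1) : ℝ) - zetaZeroCount T ≤ C * Real.log T := by
  obtain ⟨c, hc⟩ := Asymptotics.isBigO_iff.1 isBigO_zetaZeroCount_sub_zetaZeroCount_sub_one
  have hshift : Tendsto (fun T : ℝ ↦ T + 1) atTop atTop := tendsto_atTop_add_const_right _ _ tendsto_id
  obtain ⟨T₀, hT₀⟩ := Filter.eventually_atTop.1 ((hshift.eventually hc).and (eventually_ge_atTop (2 : ℝ)))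
  refine ⟨2 * max c 1, max T₀ 2, by positivity, le_max_right _ _, fun T hT ↦ ?_⟩
  obtain ⟨h1, h2⟩ := hT₀ T (le_trans (le_max_left _ _) hT)
  simp only [add_sub_cancel_right] at h1
  rw [Real.norm_eq_abs, Real.norm_eq_abs] at h1
  have hlogT : 0 ≤ Real.log T := Real.log_nonneg (by linarith)
  have hlog2 : Real.log 2 ≤ Real.log T := Real.log_le_log (by norm_num) h2
  have hlog1 : Real.log (T + 1) ≤ 2 * Real.log T := by
    calc Real.log (T + 1) ≤ Real.log (2 * T) := Real.log_le_log (by linarith) (by linarith)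
      _ = Real.log 2 + Real.log T := Real.log_mul (by norm_num) (by linarith)
      _ ≤ 2 * Real.log T := by linarith
  have habs : |Real.log (T + 1)| = Real.log (T + 1) := abs_of_nonneg (Real.log_nonneg (by linarith))
  rw [habs] at h1
  have hc1 : c ≤ max c 1 := le_max_left _ _
  have h0 : 0 ≤ max c 1 := le_trans zero_le_one (le_max_right _ _)
  calc (zetaZeroCount (T + 1) : ℝ) - zetaZeroCount T ≤ |(zetaZeroCount (T + 1) : ℝ) - zetaZeroCount T| :=
        le_abs_self _
    _ ≤ c * Real.log (T + 1) := h1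
    _ ≤ max c 1 * Real.log (T + 1) :=
        mul_le_mul_of_nonneg_right hc1 (Real.log_nonneg (by linarith))
    _ ≤ max c 1 * (2 * Real.log T) := mul_le_mul_of_nonneg_left hlog1 h0
    _ = 2 * max c 1 * Real.log T := by ring

/-- **Dyadic lower bound**: `N(2T) − N(T) ≥ (T/2π)(log T − C₁) − C₂ log T` for `T ≥ T₀`
(main terms of Riemann–von Mangoldt: `(T/2π)(log(T/2π) + 2 log 2 − 1)`).
[cite: Titchmarsh1986, Thm. 9.4] -/
theorem exists_dyadic_zetaZeroCount_ge :
    ∃ C₁ C₂ T₀ : ℝ, 0 ≤ C₁ ∧ 0 ≤ C₂ ∧ 2 ≤ T₀ ∧ ∀ T : ℝ, T₀ ≤ T →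
      T / (2 * π) * (Real.log T - C₁) - C₂ * Real.log T ≤
        (zetaZeroCount (2 * T) : ℝ) - zetaZeroCount T := by
  have hπ := Real.pi_pos
  have hπ3 := Real.pi_gt_three
  obtain ⟨c, hc⟩ := Asymptotics.isBigO_iff.1 riemann_von_mangoldt_holds
  have hshift : Tendsto (fun T : ℝ ↦ 2 * T) atTop atTop := tendsto_id.const_mul_atTop (by norm_num)
  obtain ⟨T₀, hT₀⟩ := Filter.eventually_atTop.1
    ((hc.and (hshift.eventually hc)).and (eventually_ge_atTop (2 : ℝ)))
  refine ⟨Real.log (2 * π) + 1, 3 * max c 0, max T₀ 2, by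
      have := Real.log_nonneg (show (1 : ℝ) ≤ 2 * π by linarith); linarith,
    by positivity, le_max_right _ _, fun T hT ↦ ?_⟩
  obtain ⟨⟨h1, h2⟩, h3⟩ := hT₀ T (le_trans (le_max_left _ _) hT)
  have hT2 : 2 ≤ T := h3
  have hT0 : 0 < T := by linarith
  rw [Real.norm_eq_abs, Real.norm_eq_abs, abs_of_nonneg (Real.log_nonneg (by linarith))] at h1 h2
  have hc0 : c ≤ max c 0 := le_max_left _ _
  have hm0 : 0 ≤ max c 0 := le_max_right _ _
  have hlogT : 0 ≤ Real.log T := Real.log_nonneg (by linarith)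
  have hlog2T : Real.log (2 * T) ≤ 2 * Real.log T := by
    rw [Real.log_mul (by norm_num) hT0.ne']
    have := Real.log_le_log (by norm_num) hT2
    linarith
  have hA := (abs_le.1 h1).2   -- N(T) ≤ MT(T) + c log T
  have hB := (abs_le.1 h2).1   -- N(2T) ≥ MT(2T) - c log(2T)
  -- main terms
  have hMT : (2 * T) / (2 * π) * Real.log (2 * T / (2 * π)) - 2 * T / (2 * π) -
      (T / (2 * π) * Real.log (T / (2 * π)) - T / (2 * π)) =
      T / (2 * π) * (Real.log T - (Real.log (2 * π) + 1)) + T / (2 * π) * (2 * Real.log 2) := by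
    have e1 : Real.log (2 * T / (2 * π)) = Real.log 2 + Real.log T - Real.log (2 * π) := by
      rw [Real.log_div (by positivity) (by positivity), Real.log_mul (by norm_num) hT0.ne']
    have e2 : Real.log (T / (2 * π)) = Real.log T - Real.log (2 * π) :=
      Real.log_div hT0.ne' (by positivity)
    rw [e1, e2]; ring
  have hlog2 : 0 ≤ Real.log 2 := Real.log_nonneg (by norm_num)
  have hpos : 0 ≤ T / (2 * π) * (2 * Real.log 2) := by positivity
  have hc1 : c * Real.log T ≤ max c 0 * Real.log T := mul_le_mul_of_nonneg_right hc0 hlogT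
  have hc2 : c * Real.log (2 * T) ≤ max c 0 * (2 * Real.log T) := by
    calc c * Real.log (2 * T) ≤ max c 0 * Real.log (2 * T) :=
          mul_le_mul_of_nonneg_right hc0 (Real.log_nonneg (by linarith))
      _ ≤ max c 0 * (2 * Real.log T) := mul_le_mul_of_nonneg_left hlog2T hm0
  linarith

/-! ### The real-variable limit step -/

/-- **The limit step of Levinson's method.** Suppose that for all large `T`,
`N₀(2T) − N₀(T) ≥ (N(2T) − N(T)) − (T log T/(2πR))·B − D (log(2T))²` with constants `B ≥ 0`,
`D ≥ 0`, `R > 0`. Then for every `ε > 0`, eventually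
`(1 − B/R − ε)(N(2T) − N(T)) ≤ N₀(2T) − N₀(T)` (since `N(2T) − N(T) ≥ (T/2π)(log T − C₁) − C₂ log T`
dominates `T` and `(log 2T)²`). [cite: Titchmarsh1986, §10.28] -/
theorem levinson_limit_step {R B D : ℝ} (hR : 0 < R) (hB : 0 ≤ B) (hD : 0 ≤ D)
    (h : ∀ᶠ T : ℝ in atTop,
      ((zetaZeroCount (2 * T) : ℝ) - zetaZeroCount T) - T * Real.log T / (2 * π * R) * B -
          D * Real.log (2 * T) ^ 2 ≤
        (criticalZeroCount (2 * T) : ℝ) - criticalZeroCount T) :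
    ∀ ε > 0, ∀ᶠ T : ℝ in atTop,
      (1 - B / R - ε) * ((zetaZeroCount (2 * T) : ℝ) - zetaZeroCount T) ≤
        (criticalZeroCount (2 * T) : ℝ) - criticalZeroCount T := by
  intro ε hε
  have hπ := Real.pi_pos
  have hπ3 := Real.pi_gt_three
  obtain ⟨C₁, C₂, T₀, hC₁, hC₂, hT₀2, hN⟩ := exists_dyadic_zetaZeroCount_ge
  -- the error `E_T = K T` with `K = B C₁/(2πR) + 4 B C₂/R + 16 D`
  set K : ℝ := B * C₁ / (2 * π * R) + 4 * B * C₂ / R + 16 * D with hK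
  have hK0 : 0 ≤ K := by rw [hK]; positivity
  -- thresholds: `log T ≥ 2C₁ + 4πC₂ + 1` (so `N(2T)-N(T) ≥ T log T/(4π)`) and `log T ≥ 4πK/ε`
  set Λ : ℝ := max (2 * C₁ + 4 * π * C₂ + 1) (4 * π * K / ε) with hΛ
  filter_upwards [h, eventually_ge_atTop T₀, eventually_ge_atTop (Real.exp Λ), eventually_ge_atTop (1 : ℝ)]
    with T hT hTT₀ hTΛ hT1
  have hT0 : 0 < T := by linarith
  have hL : Λ ≤ Real.log T := by
    rw [← Real.log_exp Λ]; exact Real.log_le_log (Real.exp_pos _) hTΛ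
  have hL1 : 2 * C₁ + 4 * π * C₂ + 1 ≤ Real.log T := le_trans (le_max_left _ _) hL
  have hL2 : 4 * π * K / ε ≤ Real.log T := le_trans (le_max_right _ _) hL
  have hlogT0 : 0 ≤ Real.log T := Real.log_nonneg hT1
  set L : ℝ := Real.log T with hLdef
  set Nd : ℝ := (zetaZeroCount (2 * T) : ℝ) - zetaZeroCount T with hNd
  have hNd := hN T hTT₀
  -- `log T ≤ T`, `(log 2T)² ≤ 8 T`, `log T ≤ 4T`... crude
  have hlogleT : Real.log T ≤ T := by
    have := Real.log_le_sub_one_of_pos hT0; linarith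
  have hlog2T : Real.log (2 * T) ^ 2 ≤ 8 * T := by
    -- `(log x)² ≤ 4x` for `x ≥ 1` (`log x ≤ 2√x`, Mathlib's `Real.log_le_rpow_div`), at `x = 2T`
    have hx : (1 : ℝ) ≤ 2 * T := by linarith
    have h := Real.log_le_rpow_div (by linarith : (0 : ℝ) ≤ 2 * T) (by norm_num : (0 : ℝ) < 1 / 2)
    have h0 : 0 ≤ Real.log (2 * T) := Real.log_nonneg hx
    have hs : ((2 * T) ^ (1 / 2 : ℝ)) ^ 2 = 2 * T := by
      rw [← Real.rpow_natCast, ← Real.rpow_mul (by linarith)]; norm_num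
    have h1 : Real.log (2 * T) ≤ 2 * (2 * T) ^ (1 / 2 : ℝ) := by linarith
    calc Real.log (2 * T) ^ 2 ≤ (2 * (2 * T) ^ (1 / 2 : ℝ)) ^ 2 := pow_le_pow_left₀ h0 h1 2
      _ = 8 * T := by rw [mul_pow, hs]; ring
  -- `Nd ≥ T L/(4π)`
  have hNdge : T * L / (4 * π) ≤ Nd := by
    have h1 : T / (2 * π) * (L - C₁) - C₂ * L ≤ Nd := hNd
    -- `T/(2π)(L - C₁) - C₂ L - T L/(4π) = T/(4π) (L - 2 C₁) - C₂ L ≥ T/(4π)(4π C₂ + 1) - C₂ L ≥ C₂ (T - L) ≥ 0`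
    have h2 : T * L / (4 * π) ≤ T / (2 * π) * (L - C₁) - C₂ * L := by
      have e : T / (2 * π) * (L - C₁) - C₂ * L - T * L / (4 * π) =
          T / (4 * π) * (L - 2 * C₁) - C₂ * L := by field_simp; ring
      have h3 : T / (4 * π) * (4 * π * C₂ + 1) ≤ T / (4 * π) * (L - 2 * C₁) :=
        mul_le_mul_of_nonneg_left (by linarith) (by positivity)
      have h4 : T / (4 * π) * (4 * π * C₂ + 1) = C₂ * T + T / (4 * π) := by field_simp
      have h5 : C₂ * L ≤ C₂ * T := mul_le_mul_of_nonneg_left hlogleT hC₂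
      have h6 : 0 ≤ T / (4 * π) := by positivity
      linarith
    linarith
  have hNd0 : 0 ≤ Nd := le_trans (by positivity) hNdge
  -- `T L/(2π) ≤ Nd + C₁ T/(2π) + C₂ L`
  have hTL : T * L / (2 * π) ≤ Nd + C₁ * T / (2 * π) + C₂ * L := by
    have e : T / (2 * π) * (L - C₁) = T * L / (2 * π) - C₁ * T / (2 * π) := by ring
    linarith
  -- the main step
  have hmain : (1 - B / R) * Nd - K * T ≤
      Nd - T * L / (2 * π * R) * B - D * Real.log (2 * T) ^ 2 := by
    have e1 : T * L / (2 * π * R) * B = B / R * (T * L / (2 * π)) := by field_simp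
    rw [e1]
    have h1 : B / R * (T * L / (2 * π)) ≤ B / R * (Nd + C₁ * T / (2 * π) + C₂ * L) :=
      mul_le_mul_of_nonneg_left hTL (by positivity)
    have h2 : D * Real.log (2 * T) ^ 2 ≤ D * (8 * T) := mul_le_mul_of_nonneg_left hlog2T hD
    have h3 : B / R * (C₁ * T / (2 * π)) + B / R * (C₂ * L) + D * (8 * T) ≤ K * T := by
      rw [hK]
      have h4 : B / R * (C₂ * L) ≤ B / R * (C₂ * T) :=
        mul_le_mul_of_nonneg_left (mul_le_mul_of_nonneg_left hlogleT hC₂) (by positivity)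
      have e2 : (B * C₁ / (2 * π * R) + 4 * B * C₂ / R + 16 * D) * T =
          B / R * (C₁ * T / (2 * π)) + 4 * (B / R * (C₂ * T)) + 16 * D * T := by
        field_simp
      rw [e2]
      have h5 : 0 ≤ B / R * (C₂ * T) := by positivity
      have h6 : 0 ≤ D * T := by positivity
      linarith
    have e3 : B / R * (Nd + C₁ * T / (2 * π) + C₂ * L) =
        B / R * Nd + (B / R * (C₁ * T / (2 * π)) + B / R * (C₂ * L)) := by ring
    have e4 : (1 - B / R) * Nd = Nd - B / R * Nd := by ring
    linarith
  -- `K T ≤ ε Nd`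
  have hKT : K * T ≤ ε * Nd := by
    have h1 : K * T ≤ ε * (T * L / (4 * π)) := by
      -- `L ≥ 4πK/ε` ⇒ `ε T L/(4π) ≥ K T`
      have h2 : 4 * π * K ≤ ε * L := by
        have := mul_le_mul_of_nonneg_left hL2 hε.le
        rwa [mul_div_cancel₀ _ hε.ne'] at this
      have e : ε * (T * L / (4 * π)) = T * (ε * L) / (4 * π) := by ring
      rw [e, le_div_iff₀ (by positivity)]
      nlinarith
    exact h1.trans (mul_le_mul_of_nonneg_left hNdge hε.le)
  have e5 : (1 - B / R - ε) * Nd = (1 - B / R) * Nd - ε * Nd := by ring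
  rw [e5]
  linarith

/-! ### The arithmetic of one dyadic block -/

/-- The bookkeeping of one dyadic block `[T, 2T]` of Levinson's method (all quantities real;
`Nd = N(2T) − N(T)`, `Nd' = N(T₂') − N(T₁')`, `N0 = N₀(2T) − N₀(T)`, `N0' = N₀(T₂') − N₀(T₁')`,
`NV` the zeros of `V`, `σ = ½ − a' ≥ R/L`, `U = T₂' − T₁' ≤ T`, `ℓ = log 2T ≥ log T₂', L`).
[folklore] -/
theorem levinson_block_arith {Nd Nd' N0 N0' NV σ U T L ℓ ℓ₂ lm lam lc ε₂ kk R C₁ C₂ C₃ : ℝ}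
    (hR : 0 < R) (hL : 0 < L) (hC₁ : 0 ≤ C₁) (hC₂ : 0 ≤ C₂) (hC₃ : 0 ≤ C₃) (hkk : 0 ≤ kk)
    (hT : 0 ≤ T) (hU : 0 ≤ U) (hUT : U ≤ T) (hℓ1 : 1 ≤ ℓ) (hℓ₂ : ℓ₂ ≤ ℓ) (hLℓ : L ≤ ℓ)
    (hlc : 0 ≤ lc) (hε₂ : 0 ≤ ε₂) (hlam : 0 ≤ lam) (hlm : lm ≤ lc + 2 * ε₂) (hσ : R / L ≤ σ)
    (hmil : Nd' - 2 * NV - C₁ * ℓ₂ ≤ N0') (hmono : N0' ≤ N0) (hloc : Nd - 2 * C₂ * ℓ ≤ Nd')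
    (hLW : 2 * π * σ * NV ≤ U / 2 * lm + U * lam + C₃ * (ℓ₂ + kk * L)) :
    Nd - T * L / (2 * π * R) * (lc + 2 * ε₂ + 2 * lam) -
        (C₁ + 2 * C₂ + C₃ * (1 + kk) / (π * R)) * ℓ ^ 2 ≤ N0 := by
  have hπ := Real.pi_pos
  set B : ℝ := lc + 2 * ε₂ + 2 * lam with hB
  have hB0 : 0 ≤ B := by rw [hB]; linarith only [hlc, hε₂, hlam]
  set X : ℝ := T / 2 * B + C₃ * (1 + kk) * ℓ with hX
  have hX0 : 0 ≤ X := by rw [hX]; positivity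
  -- the Littlewood right side is `≤ X`
  have hRHS : U / 2 * lm + U * lam + C₃ * (ℓ₂ + kk * L) ≤ X := by
    have h1 : U / 2 * lm ≤ T / 2 * (lc + 2 * ε₂) := by
      rcases le_or_gt 0 lm with h | h
      · have h1a : U / 2 * lm ≤ T / 2 * lm := mul_le_mul_of_nonneg_right (by linarith only [hUT]) h
        have h1b : T / 2 * lm ≤ T / 2 * (lc + 2 * ε₂) := mul_le_mul_of_nonneg_left hlm (by positivity)
        exact h1a.trans h1b
      · have h1a : U / 2 * lm ≤ 0 := mul_nonpos_of_nonneg_of_nonpos (by positivity) h.le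
        have h1b : 0 ≤ T / 2 * (lc + 2 * ε₂) := by positivity
        exact h1a.trans h1b
    have h2 : U * lam ≤ T * lam := mul_le_mul_of_nonneg_right hUT hlam
    have h3a : kk * L ≤ kk * ℓ := mul_le_mul_of_nonneg_left hLℓ hkk
    have h3b : ℓ₂ + kk * L ≤ (1 + kk) * ℓ := by linarith only [hℓ₂, h3a]
    have h3 : C₃ * (ℓ₂ + kk * L) ≤ C₃ * ((1 + kk) * ℓ) := mul_le_mul_of_nonneg_left h3b hC₃
    have e : X = T / 2 * (lc + 2 * ε₂) + T * lam + C₃ * ((1 + kk) * ℓ) := by rw [hX, hB]; ring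
    rw [e]
    linarith only [h1, h2, h3]
  -- `2 NV ≤ (L/(πR)) X`
  have hσ0 : 0 < σ := lt_of_lt_of_le (div_pos hR hL) hσ
  have hRσL : R ≤ σ * L := by rwa [div_le_iff₀ hL] at hσ
  have h1 : 2 * π * σ * NV ≤ X := hLW.trans hRHS
  have h4 : σ * (2 * π * R * NV) ≤ σ * (L * X) := by
    calc σ * (2 * π * R * NV) = R * (2 * π * σ * NV) := by ring
      _ ≤ R * X := mul_le_mul_of_nonneg_left h1 hR.le
      _ ≤ σ * L * X := mul_le_mul_of_nonneg_right hRσL hX0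
      _ = σ * (L * X) := by ring
  have h5 : 2 * π * R * NV ≤ L * X := le_of_mul_le_mul_left h4 hσ0
  have h2NV : 2 * NV ≤ L / (π * R) * X := by
    rw [div_mul_eq_mul_div, le_div_iff₀ (by positivity)]
    linarith only [h5]
  -- collect
  have e1 : L / (π * R) * X = T * L / (2 * π * R) * B + C₃ * (1 + kk) / (π * R) * (L * ℓ) := by
    rw [hX]; field_simp
  rw [e1] at h2NV
  have hLℓ2 : L * ℓ ≤ ℓ ^ 2 := by nlinarith only [hLℓ, hL, hℓ1]
  have hℓℓ : ℓ ≤ ℓ ^ 2 := by nlinarith only [hℓ1]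
  have hℓ₂ℓ : ℓ₂ ≤ ℓ ^ 2 := hℓ₂.trans hℓℓ
  have hc3 : 0 ≤ C₃ * (1 + kk) / (π * R) := by positivity
  have h6 : C₃ * (1 + kk) / (π * R) * (L * ℓ) ≤ C₃ * (1 + kk) / (π * R) * ℓ ^ 2 :=
    mul_le_mul_of_nonneg_left hLℓ2 hc3
  have h7 : C₁ * ℓ₂ ≤ C₁ * ℓ ^ 2 := mul_le_mul_of_nonneg_left hℓ₂ℓ hC₁
  have h8 : 2 * C₂ * ℓ ≤ 2 * C₂ * ℓ ^ 2 := mul_le_mul_of_nonneg_left hℓℓ (by positivity)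
  have e2 : (C₁ + 2 * C₂ + C₃ * (1 + kk) / (π * R)) * ℓ ^ 2 =
      C₁ * ℓ ^ 2 + 2 * C₂ * ℓ ^ 2 + C₃ * (1 + kk) / (π * R) * ℓ ^ 2 := by ring
  rw [e2]
  linarith only [hmil, hmono, hloc, h2NV, h6, h7, h8]

/-! ### The conditional theorem -/

set_option maxHeartbeats 400000 in
/-- **Levinson's method, conditional on the mollified mean square** (Levinson 1974; Conrey 1983,
§4; Titchmarsh §10.28; PRZZ 2020 (1.9)–(1.10)). Let `𝜙 ∈ ℝ[X]` with `𝜙(x) + 𝜙(1−x) = c ≠ 0` and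
`𝜙(0) = 1`, `R > 0`, `c_ms ≥ 1`, and let `ψ_T` (`T` real) be entire functions with
(i) `‖ψ_T(z)‖ ≤ T^k` for `0 ≤ Re z`, `0 ≤ Im z ≤ 3T` and all large `T`;
(ii) for every `ε > 0` there is `m₀` such that for every `m ≥ m₀`, for all large `T`,
`‖ψ_T(m + ½ + it) − 1‖ ≤ ε` for `t ∈ [T, 2T]`;
(iii) for every `ε > 0`, for all large `T`,
`∫_T^{2T} |ψ_T(a_T+it) V_T(a_T+it)|² dt ≤ (c_ms + ε) T`, `a_T = ½ − R/log T`,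
`V_T = conreyV 𝜙 (log T)`.
Then `1 − (log c_ms)/R ≤ κ` (`κ = criticalLineProportion = liminf N₀(T)/N(T)`).
[cite: Conrey1983, §4 (3)–(4)] -/
theorem levinson_criticalLineProportion_ge {φ : ℝ[X]} {c : ℝ} (hφ : φ + φ.comp (1 - X) = C c)
    (hc : c ≠ 0) (hφ1 : φ.coeff 0 = 1) {R : ℝ} (hR : 0 < R) {cms : ℝ} (hcms : 1 ≤ cms)
    (ψ : ℝ → ℂ → ℂ) (hψd : ∀ T, Differentiable ℂ (ψ T))
    (hψB : ∃ k : ℝ, ∀ᶠ T : ℝ in atTop, ∀ z : ℂ, 0 ≤ z.re → 0 ≤ z.im → z.im ≤ 3 * T → ‖ψ T z‖ ≤ T ^ k)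
    (hψ1 : ∀ ε > 0, ∃ m₀ : ℕ, ∀ m : ℕ, m₀ ≤ m → ∀ᶠ T : ℝ in atTop, ∀ t ∈ Icc T (2 * T),
      ‖ψ T ((((m : ℝ) + 1 / 2 : ℝ) : ℂ) + t * I) - 1‖ ≤ ε)
    (hms : ∀ ε > 0, ∀ᶠ T : ℝ in atTop,
      ∫ t in T..2 * T, ‖ψ T (((1 / 2 - R / Real.log T : ℝ) : ℂ) + t * I) *
        conreyV φ (Real.log T) (((1 / 2 - R / Real.log T : ℝ) : ℂ) + t * I)‖ ^ 2 ≤ (cms + ε) * T) :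
    1 - Real.log cms / R ≤ criticalLineProportion := by
  have hπ := Real.pi_pos
  have hπ3 := Real.pi_gt_three
  have hφ0 : φ.coeff 0 ≠ 0 := by rw [hφ1]; norm_num
  have hlc : 0 ≤ Real.log cms := Real.log_nonneg hcms
  apply le_criticalLineProportion_of_dyadic tendsto_zetaZeroCount_atTop_holds
  intro ε₀ hε₀
  -- budgets
  set ε₂ : ℝ := R * ε₀ / 8 with hε₂
  have hε₂0 : 0 < ε₂ := by positivity
  set θ₁ : ℝ := min (1 / 2) (1 - Real.exp (-(R * ε₀ / 8))) with hθ₁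
  have hexp1 : Real.exp (-(R * ε₀ / 8)) < 1 := Real.exp_lt_one_iff.2 (by
    have : 0 < R * ε₀ / 8 := by positivity
    linarith)
  have hθ₁pos : 0 < θ₁ := lt_min (by norm_num) (by linarith)
  have hθ₁half : θ₁ ≤ 1 / 2 := min_le_left _ _
  have hθ₁exp : θ₁ ≤ 1 - Real.exp (-(R * ε₀ / 8)) := min_le_right _ _
  -- the line `σ = m + ½`
  obtain ⟨m₀, hm₀⟩ := hψ1 (θ₁ / 4) (by positivity)
  set m : ℕ := max m₀ (max 4 (⌈8 / θ₁⌉₊ + 1)) with hmdef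
  have hmm₀ : m₀ ≤ m := le_max_left _ _
  have hm4 : 4 ≤ m := le_trans (le_max_left _ _) (le_max_right _ _)
  have hm' : (4 : ℝ) ≤ m := by exact_mod_cast hm4
  have hmθ : 1 / ((m : ℝ) - 1 / 2) ≤ θ₁ / 8 := by
    have h1 : (⌈8 / θ₁⌉₊ + 1 : ℕ) ≤ m := le_trans (le_max_right _ _) (le_max_right _ _)
    have h2 : ((⌈8 / θ₁⌉₊ + 1 : ℕ) : ℝ) ≤ m := by exact_mod_cast h1
    push_cast at h2
    have h3 : 8 / θ₁ ≤ ⌈8 / θ₁⌉₊ := Nat.le_ceil _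
    have h4 : 8 / θ₁ ≤ (m : ℝ) - 1 / 2 := by linarith
    rw [div_le_iff₀ (by linarith)]
    rw [div_le_iff₀ hθ₁pos] at h4
    nlinarith
  set η : ℝ := θ₁ / 8 with hη
  set θψ : ℝ := θ₁ / 4 with hθψ
  set θV : ℝ := 1 / ((m : ℝ) - 1 / 2) + η with hθV
  have hθV0 : 0 < θV := by
    rw [hθV]; have : 0 < (m : ℝ) - 1 / 2 := by linarith
    positivity
  have hθVle : θV ≤ θ₁ / 4 := by rw [hθV, hη]; linarith
  set θ : ℝ := θV + θψ + θV * θψ with hθdef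
  have hθle : θ ≤ θ₁ := by
    rw [hθdef, hθψ]
    have : θV * (θ₁ / 4) ≤ (θ₁ / 4) * (θ₁ / 4) := mul_le_mul_of_nonneg_right hθVle (by positivity)
    nlinarith
  have hθhalf : θ ≤ 1 / 2 := hθle.trans hθ₁half
  have hθ0 : 0 < θ := by rw [hθdef]; positivity
  set lam : ℝ := -Real.log (1 - θ) with hlamdef
  have h1θ : 0 < 1 - θ := by linarith
  have hlam0 : 0 ≤ lam := by
    rw [hlamdef]; have := Real.log_nonpos h1θ.le (by linarith); linarith
  have hlam : lam ≤ R * ε₀ / 8 := by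
    rw [hlamdef, neg_le, ← Real.log_exp (-(R * ε₀ / 8))]
    exact Real.log_le_log (Real.exp_pos _) (by linarith)
  -- structural constants
  obtain ⟨L₁, U₁, C₁, hL₁, hU₁, hC₁, hMil⟩ := levinsonConrey_inequality hφ hc hφ0
  have hθexp : 1 / ((m : ℝ) - 1 / 2) + η + θψ + (1 / ((m : ℝ) - 1 / 2) + η) * θψ ≤ 1 / 2 := hθhalf
  obtain ⟨L₂, U₂, C₃, hL₂, hU₂, hC₃, hLW⟩ :=
    levinson_littlewood_bound φ hφ0 hm4 (η := η) (θψ := θψ) (by positivity) (by positivity) hθexp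
  obtain ⟨L₃, U₃', hL₃, hU₃', hVedge⟩ := conreyV_halfInteger_edge φ hφ0 (le_trans (by norm_num) hm4)
    (η := η) (by positivity)
  obtain ⟨C₂, U₃, hC₂, hU₃2, hloc⟩ := exists_zetaZeroCount_add_one_sub_le
  obtain ⟨k, hk⟩ := hψB
  set kk : ℝ := max k 0 with hkk
  have hkk0 : 0 ≤ kk := le_max_right _ _
  have hψ1' := hm₀ m hmm₀
  have hms' := hms ε₂ hε₂0
  set b : ℝ := (m : ℝ) + 1 / 2 with hb
  have hb4 : 9 / 2 ≤ b := by rw [hb]; linarith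
  -- `B`, `D` for the limit step
  set B : ℝ := Real.log cms + 2 * ε₂ + 2 * lam with hBdef
  have hB0 : 0 ≤ B := by rw [hBdef]; positivity
  set D : ℝ := C₁ + 2 * C₂ + C₃ * (1 + kk) / (π * R) with hDdef
  have hD0 : 0 ≤ D := by rw [hDdef]; positivity
  -- thresholds in `T`
  set Lmax : ℝ := max (max L₁ L₂) (max L₃ (8 * R)) with hLmax
  set Tmin : ℝ := max (max (max U₁ U₂) (max U₃' U₃)) (max (max (Real.exp Lmax) (2 * b + 3))
    (2 * cms / ε₂ + 5)) with hTmin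
  have key : ∀ᶠ T : ℝ in atTop,
      ((zetaZeroCount (2 * T) : ℝ) - zetaZeroCount T) - T * Real.log T / (2 * π * R) * B -
          D * Real.log (2 * T) ^ 2 ≤
        (criticalZeroCount (2 * T) : ℝ) - criticalZeroCount T := by
    filter_upwards [hk, hψ1', hms', eventually_ge_atTop Tmin] with T hkT hψT hmsT hTge
    -- unpack thresholds
    have hTU₁ : U₁ ≤ T := le_trans (le_trans (le_trans (le_max_left _ _) (le_max_left _ _)) (le_max_left _ _)) hTge
    have hTU₂ : U₂ ≤ T := le_trans (le_trans (le_trans (le_max_right _ _) (le_max_left _ _)) (le_max_left _ _)) hTge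
    have hTU₃' : U₃' ≤ T := le_trans (le_trans (le_trans (le_max_left _ _) (le_max_right _ _)) (le_max_left _ _)) hTge
    have hTU₃ : U₃ ≤ T := le_trans (le_trans (le_trans (le_max_right _ _) (le_max_right _ _)) (le_max_left _ _)) hTge
    have hTexp : Real.exp Lmax ≤ T := le_trans (le_trans (le_trans (le_max_left _ _) (le_max_left _ _)) (le_max_right _ _)) hTge
    have hTb : 2 * b + 3 ≤ T := le_trans (le_trans (le_trans (le_max_right _ _) (le_max_left _ _)) (le_max_right _ _)) hTge
    have hTcms : 2 * cms / ε₂ + 5 ≤ T := le_trans (le_trans (le_max_right _ _) (le_max_right _ _)) hTge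
    have hT2 : 2 ≤ T := le_trans hU₃2 hTU₃
    have hT0 : 0 < T := by linarith only [hT2]
    have hT1 : 1 ≤ T := by linarith only [hT2]
    set L : ℝ := Real.log T with hLdef
    have hLge : Lmax ≤ L := by rw [hLdef, ← Real.log_exp Lmax]; exact Real.log_le_log (Real.exp_pos _) hTexp
    have hLL₁ : L₁ ≤ L := le_trans (le_trans (le_max_left _ _) (le_max_left _ _)) hLge
    have hLL₂ : L₂ ≤ L := le_trans (le_trans (le_max_right _ _) (le_max_left _ _)) hLge
    have hLL₃ : L₃ ≤ L := le_trans (le_trans (le_max_left _ _) (le_max_right _ _)) hLge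
    have hL8R : 8 * R ≤ L := le_trans (le_trans (le_max_right _ _) (le_max_right _ _)) hLge
    have hL0 : 0 < L := by linarith only [hL8R, hR]
    have hL1 : 1 ≤ L := by linarith only [hLL₁, hL₁]
    set a : ℝ := 1 / 2 - R / L with hadef
    have hRL : R / L ≤ 1 / 8 := by rw [div_le_iff₀ hL0]; linarith only [hL8R]
    have hRL0 : 0 < R / L := by positivity
    have ha38 : 3 / 8 ≤ a := by rw [hadef]; linarith only [hRL]
    have ha12 : a < 1 / 2 := by rw [hadef]; linarith only [hRL0]
    set V : ℂ → ℂ := conreyV φ L with hVdef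
    set f : ℂ → ℂ := fun z ↦ ψ T z * V z with hfdef
    -- analyticity of `f` off the real axis
    have hfa : ∀ z : ℂ, z.im ≠ 0 → AnalyticAt ℂ f z := fun z hz ↦
      ((hψd T).analyticAt z).mul (analyticAt_conreyV_of_im_ne_zero φ L hz)
    have hfan : ∀ {x₁ x₂ t₁ t₂ : ℝ}, 0 < t₁ → AnalyticOnNhd ℂ f (Icc x₁ x₂ ×ℂ Icc t₁ t₂) := by
      intro x₁ x₂ t₁ t₂ ht₁ z hz
      refine hfa z ?_
      have := (Complex.mem_reProdIm.1 hz).2.1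
      intro h0; rw [h0] at this; linarith only [this, ht₁]
    -- `f ≠ 0` at the right-edge points `b + it`, `t ∈ [T, 2T]`
    have hfne : ∀ t ∈ Icc T (2 * T), f ((b : ℂ) + t * I) ≠ 0 := by
      intro t ht h0
      have hV1 : ‖V ((b : ℂ) + t * I) - (φ.coeff 0 : ℂ)‖ ≤ θV * |φ.coeff 0| :=
        hVedge L hLL₃ t (le_trans hTU₃' ht.1)
      rw [hφ1] at hV1
      simp only [ofReal_one, abs_one, mul_one] at hV1
      have hψ1t : ‖ψ T ((b : ℂ) + t * I) - 1‖ ≤ θ₁ / 4 := hψT t ht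
      have hVne : V ((b : ℂ) + t * I) ≠ 0 := by
        intro hV0; rw [hV0, zero_sub, norm_neg, norm_one] at hV1; linarith only [hV1, hθVle, hθ₁half]
      have hψne : ψ T ((b : ℂ) + t * I) ≠ 0 := by
        intro hψ0; rw [hψ0, zero_sub, norm_neg, norm_one] at hψ1t; linarith only [hψ1t, hθ₁half]
      exact mul_ne_zero hψne hVne h0
    -- good heights
    have hb18 : (1 / 8 : ℝ) ≤ b := by linarith only [hb4]
    obtain ⟨T₁, hT₁I, hT₁⟩ := exists_height_avoiding_zeros (f := f) hb18 (show T < T + 1 by linarith only)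
      (hfan hT0) (w := (b : ℂ) + T * I)
      (Complex.mem_reProdIm.2 ⟨by simpa using hb18, by simp⟩) (hfne T ⟨le_rfl, by linarith only [hT0]⟩)
    obtain ⟨T₂, hT₂I, hT₂⟩ := exists_height_avoiding_zeros (f := f) hb18 (show 2 * T - 1 < 2 * T by linarith only)
      (hfan (by linarith only [hT2] : (0:ℝ) < 2 * T - 1)) (w := (b : ℂ) + (2 * T) * I)
      (Complex.mem_reProdIm.2 ⟨by simpa using hb18, by simp⟩)
      (by have := hfne (2 * T) ⟨by linarith only [hT0], le_rfl⟩; push_cast at this ⊢; exact this)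
    have hT₁T : T < T₁ := hT₁I.1
    have hT₁T' : T₁ < T + 1 := hT₁I.2
    have hT₂T : 2 * T - 1 < T₂ := hT₂I.1
    have hT₂T' : T₂ < 2 * T := hT₂I.2
    have hT₁₂ : T₁ < T₂ := by linarith only [hT₁T', hT₂T, hT2]
    have hT₁0 : 0 < T₁ := by linarith only [hT₁T, hT0]
    -- good abscissa
    obtain ⟨a', ha'I, ha'0, ha'int⟩ := exists_abscissa_avoiding_zeros_integral_le (f := f) (a := a)
      (δ := 1 / 8) (by norm_num) hT₁₂ (hfan hT₁0) (w := (a : ℂ) + T₁ * I)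
      (Complex.mem_reProdIm.2 ⟨by simp, by simpa using hT₁₂.le⟩)
      (hT₁ a ⟨by linarith only [ha38], by linarith only [ha12, hb4]⟩) hε₂0
    have ha'1 : 1 / 8 ≤ a' := by linarith only [ha'I.1, ha38]
    have ha'2 : a' < 1 / 2 := lt_trans ha'I.2 ha12
    have hσ : R / L ≤ 1 / 2 - a' := by rw [hadef] at ha'I; linarith only [ha'I.2]
    -- the zero-detection inequality on `[T₁, T₂]`
    have hVb : ∀ {t : ℝ}, (∀ x ∈ Icc (1 / 8 : ℝ) b, f (x + t * I) ≠ 0) →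
        ∀ x ∈ Icc (1 / 2 : ℝ) (5 / 2), V (x + t * I) ≠ 0 := by
      intro t h x hx hV0
      exact h x ⟨by linarith [hx.1], by linarith [hx.2]⟩ (by simp only [hfdef, hV0, mul_zero])
    have hmil := hMil L hLL₁ T₁ T₂ (by linarith only [hTU₁, hT₁T]) hT₁₂ (hVb hT₁) (hVb hT₂)
    -- the Littlewood step on `[a', b] × [T₁, T₂]`
    have hBψ1 : 1 ≤ T ^ kk := Real.one_le_rpow hT1 hkk0
    have aux : ∀ T' : ℝ, T ≤ T' → T' ≤ 2 * T → ∀ z ∈ closedBall ((b : ℂ) + T' * I) b,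
        0 ≤ z.re ∧ 0 ≤ z.im ∧ z.im ≤ 3 * T := by
      intro T' h1' h2' z hz
      rw [mem_closedBall_iff_norm] at hz
      have hre := Complex.abs_re_le_norm (z - ((b : ℂ) + T' * I))
      have him := Complex.abs_im_le_norm (z - ((b : ℂ) + T' * I))
      simp only [sub_re, add_re, ofReal_re, mul_re, I_re, mul_zero, ofReal_im, I_im, mul_one,
        sub_self, add_zero, sub_im, add_im, mul_im, zero_add] at hre him
      obtain ⟨h1, h2⟩ := abs_le.1 (hre.trans hz)
      obtain ⟨h3, h4⟩ := abs_le.1 (him.trans hz)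
      exact ⟨by linarith only [h1, hz], by linarith only [h3, h1', hTb, hb4], by linarith only [h4, h2', hTb, hT0]⟩
    have hdisc : ∀ z ∈ closedBall ((b : ℂ) + T₁ * I) b ∪ closedBall ((b : ℂ) + T₂ * I) b, ‖ψ T z‖ ≤ T ^ kk := by
      intro z hz
      have hz' : 0 ≤ z.re ∧ 0 ≤ z.im ∧ z.im ≤ 3 * T := by
        rcases hz with hz | hz
        · exact aux T₁ hT₁T.le (by linarith only [hT₁T', hT2]) z hz
        · exact aux T₂ (by linarith only [hT₂T, hT2]) hT₂T'.le z hz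
      exact (hkT z hz'.1 hz'.2.1 hz'.2.2).trans (Real.rpow_le_rpow_of_exponent_le hT1 (le_max_left _ _))
    have hright : ∀ y ∈ Icc T₁ T₂, ‖ψ T ((b : ℂ) + y * I) - 1‖ ≤ θψ := fun y hy ↦
      hψT y ⟨by linarith only [hy.1, hT₁T], by linarith only [hy.2, hT₂T']⟩
    have hbot' : ∀ x ∈ Icc a' b, f (x + T₁ * I) ≠ 0 := fun x hx ↦ hT₁ x ⟨by linarith only [hx.1, ha'1], hx.2⟩
    have htop' : ∀ x ∈ Icc a' b, f (x + T₂ * I) ≠ 0 := fun x hx ↦ hT₂ x ⟨by linarith only [hx.1, ha'1], hx.2⟩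
    have hlw := hLW L hLL₂ a' T₁ T₂ ha'1 ha'2 (by linarith only [hTU₂, hT₁T]) hT₁₂ (ψ T) (T ^ kk) (hψd T) hBψ1 hdisc hright
      hbot' htop' ha'0
    rw [hφ1, abs_one, mul_one] at hlw
    -- the mean square on `[T₁, T₂]` at `a'`
    set U : ℝ := T₂ - T₁ with hUdef
    have hU0 : 0 < U := by rw [hUdef]; linarith only [hT₁₂]
    have hUT : U ≤ T := by rw [hUdef]; linarith only [hT₁T, hT₂T']
    have hU2 : T - 2 ≤ U := by rw [hUdef]; linarith only [hT₁T', hT₂T]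
    have hcont : ∀ x : ℝ, ContinuousOn (fun t : ℝ ↦ ‖f (x + t * I)‖ ^ 2) (Icc T (2 * T)) := by
      intro x t ht
      have h1 : ContinuousAt f ((x : ℂ) + t * I) := (hfa _ (by simp; linarith only [ht.1, hT0])).continuousAt
      have hl : Continuous fun t : ℝ ↦ (x : ℂ) + t * I := by fun_prop
      exact ((h1.comp (f := fun t : ℝ ↦ (x : ℂ) + t * I) hl.continuousAt).norm.pow 2).continuousWithinAt
    have hint_a : ∫ t in T₁..T₂, ‖f (a + t * I)‖ ^ 2 ≤ (cms + ε₂) * T := by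
      calc ∫ t in T₁..T₂, ‖f (a + t * I)‖ ^ 2 ≤ ∫ t in T..2 * T, ‖f (a + t * I)‖ ^ 2 :=
            intervalIntegral.integral_mono_interval hT₁T.le hT₁₂.le hT₂T'.le
              (Eventually.of_forall fun t ↦ by positivity)
              ((hcont a).intervalIntegrable_of_Icc (by linarith only [hT0]))
        _ ≤ (cms + ε₂) * T := hmsT
    have hint_a' : ∫ t in T₁..T₂, ‖f (a' + t * I)‖ ^ 2 ≤ (cms + ε₂) * T + ε₂ := by linarith only [ha'int, hint_a]
    -- positivity of the mean square at `a'`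
    have hcont' : ContinuousOn (fun t : ℝ ↦ ‖f (a' + t * I)‖ ^ 2) (Icc T₁ T₂) :=
      (hcont a').mono (Icc_subset_Icc hT₁T.le hT₂T'.le)
    have hms_pos : 0 < ∫ t in T₁..T₂, ‖f (a' + t * I)‖ ^ 2 :=
      intervalIntegral.intervalIntegral_pos_of_pos_on (hcont'.intervalIntegrable_of_Icc hT₁₂.le)
        (fun t ht ↦ by
          have := ha'0 t (Ioo_subset_Icc_self ht)
          positivity) hT₁₂
    set lm : ℝ := Real.log (U⁻¹ * ∫ t in T₁..T₂, ‖f (a' + t * I)‖ ^ 2) with hlmdef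
    have hlm : lm ≤ Real.log cms + 2 * ε₂ := by
      have h1 : U⁻¹ * ∫ t in T₁..T₂, ‖f (a' + t * I)‖ ^ 2 ≤ cms + 2 * ε₂ := by
        rw [inv_mul_le_iff₀ hU0]
        -- `(cms + ε₂) T + ε₂ ≤ (cms + 2ε₂)(T - 2) ≤ (cms + 2ε₂) U`
        have h2 : (cms + ε₂) * T + ε₂ ≤ (cms + 2 * ε₂) * (T - 2) := by
          have h3 : 2 * cms + 5 * ε₂ ≤ ε₂ * T := by
            have := mul_le_mul_of_nonneg_left hTcms hε₂0.le
            rw [mul_add, mul_div_assoc', mul_comm ε₂ (2 * cms), mul_div_assoc, div_self hε₂0.ne', mul_one] at this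
            linarith only [this]
          nlinarith only [h3, hε₂0, hcms, hT0]
        have h4 : (cms + 2 * ε₂) * (T - 2) ≤ (cms + 2 * ε₂) * U :=
          mul_le_mul_of_nonneg_left hU2 (by positivity)
        linarith only [hint_a', h2, h4]
      calc lm ≤ Real.log (cms + 2 * ε₂) := Real.log_le_log (by positivity) h1
        _ = Real.log cms + Real.log ((cms + 2 * ε₂) / cms) := by
            rw [← Real.log_mul (by positivity) (by positivity)]; congr 1; field_simp
        _ ≤ Real.log cms + 2 * ε₂ := by
            have h5 := Real.log_le_sub_one_of_pos (show 0 < (cms + 2 * ε₂) / cms by positivity)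
            have h6 : (cms + 2 * ε₂) / cms - 1 = 2 * ε₂ / cms := by field_simp; ring
            have h7 : 2 * ε₂ / cms ≤ 2 * ε₂ := div_le_self (by positivity) hcms
            linarith only [h5, h6, h7]
    -- the block arithmetic
    set ℓ : ℝ := Real.log (2 * T) with hℓdef
    have hℓL : L ≤ ℓ := Real.log_le_log hT0 (by linarith only [hT0])
    have hℓ1 : 1 ≤ ℓ := hL1.trans hℓL
    have hℓ₂ : Real.log T₂ ≤ ℓ := Real.log_le_log (by linarith only [hT₁0, hT₁₂]) hT₂T'.le
    have hlogBψ : Real.log (T ^ kk) = kk * L := Real.log_rpow hT0 kk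
    rw [hlogBψ] at hlw
    -- local bounds: `N(T₁) - N(T) ≤ C₂ log T ≤ C₂ ℓ`, `N(2T) - N(T₂) ≤ C₂ log T₂' ≤ C₂ ℓ`
    have hlocT := hloc T hTU₃
    have hlocT₂ := hloc T₂ (by linarith only [hTU₃, hT₂T, hT2])
    have hm1 : (zetaZeroCount T₁ : ℝ) ≤ zetaZeroCount (T + 1) := by exact_mod_cast zetaZeroCount_mono hT₁T'.le
    have hm2 : (zetaZeroCount (2 * T) : ℝ) ≤ zetaZeroCount (T₂ + 1) := by
      exact_mod_cast zetaZeroCount_mono (by linarith only [hT₂T] : 2 * T ≤ T₂ + 1)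
    have hlogT_le : Real.log T ≤ ℓ := hℓL
    have hNd' : ((zetaZeroCount (2 * T) : ℝ) - zetaZeroCount T) - 2 * C₂ * ℓ ≤
        (zetaZeroCount T₂ : ℝ) - zetaZeroCount T₁ := by
      have h1 : C₂ * Real.log T ≤ C₂ * ℓ := mul_le_mul_of_nonneg_left hlogT_le hC₂.le
      have h2 : C₂ * Real.log T₂ ≤ C₂ * ℓ := mul_le_mul_of_nonneg_left hℓ₂ hC₂.le
      linarith only [h1, h2, hlocT, hlocT₂, hm1, hm2]
    have hmono : (criticalZeroCount T₂ : ℝ) - criticalZeroCount T₁ ≤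
        (criticalZeroCount (2 * T) : ℝ) - criticalZeroCount T := by
      have h1 : (criticalZeroCount T : ℝ) ≤ criticalZeroCount T₁ := by exact_mod_cast criticalZeroCount_mono hT₁T.le
      have h2 : (criticalZeroCount T₂ : ℝ) ≤ criticalZeroCount (2 * T) := by
        exact_mod_cast criticalZeroCount_mono hT₂T'.le
      linarith only [h1, h2]
    have hmil' : ((zetaZeroCount T₂ : ℝ) - zetaZeroCount T₁) -
        2 * ∑ᶠ ρ ∈ {ρ : ℂ | conreyV φ L ρ = 0 ∧ ρ ∈ Ioo (1 / 2 : ℝ) (5 / 2) ×ℂ Ioo T₁ T₂},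
          ((meromorphicOrderAt (conreyV φ L) ρ).untop₀ : ℝ) - C₁ * Real.log T₂ ≤
        (criticalZeroCount T₂ : ℝ) - criticalZeroCount T₁ := by
      linarith only [hmil]
    have harith := levinson_block_arith (Nd := (zetaZeroCount (2 * T) : ℝ) - zetaZeroCount T)
      (Nd' := (zetaZeroCount T₂ : ℝ) - zetaZeroCount T₁)
      (N0 := (criticalZeroCount (2 * T) : ℝ) - criticalZeroCount T)
      (N0' := (criticalZeroCount T₂ : ℝ) - criticalZeroCount T₁)
      (NV := ∑ᶠ ρ ∈ {ρ : ℂ | conreyV φ L ρ = 0 ∧ ρ ∈ Ioo (1 / 2 : ℝ) (5 / 2) ×ℂ Ioo T₁ T₂},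
          ((meromorphicOrderAt (conreyV φ L) ρ).untop₀ : ℝ))
      (σ := 1 / 2 - a') (U := U) (T := T) (L := L) (ℓ := ℓ) (ℓ₂ := Real.log T₂) (lm := lm) (lam := lam)
      (lc := Real.log cms) (ε₂ := ε₂) (kk := kk) (R := R) (C₁ := C₁) (C₂ := C₂) (C₃ := C₃)
      hR hL0 hC₁.le hC₂.le hC₃.le hkk0 hT0.le hU0.le hUT hℓ1 hℓ₂ hℓL hlc hε₂0.le hlam0 hlm
      hσ hmil' hmono hNd' (by simpa only [hUdef] using hlw)
    simpa only [hBdef, hDdef] using harith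
  -- the limit step
  have hlim := levinson_limit_step hR hB0 hD0 key (ε₀ / 2) (by positivity)
  have hBR : B / R ≤ Real.log cms / R + ε₀ / 2 := by
    rw [hBdef, add_assoc, add_div, add_le_add_iff_left, div_le_iff₀ hR]
    have : 2 * ε₂ + 2 * lam ≤ R * ε₀ / 2 := by rw [hε₂]; linarith
    linarith
  filter_upwards [hlim, eventually_ge_atTop (0 : ℝ)] with T hT hT0
  have hNd0 : 0 ≤ (zetaZeroCount (2 * T) : ℝ) - zetaZeroCount T := by
    have : (zetaZeroCount T : ℝ) ≤ zetaZeroCount (2 * T) := by exact_mod_cast zetaZeroCount_mono (by linarith)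
    linarith
  have h1 : (1 - Real.log cms / R - ε₀) * ((zetaZeroCount (2 * T) : ℝ) - zetaZeroCount T) ≤
      (1 - B / R - ε₀ / 2) * ((zetaZeroCount (2 * T) : ℝ) - zetaZeroCount T) :=
    mul_le_mul_of_nonneg_right (by linarith) hNd0
  exact h1.trans hT

end Literature.NumberTheory.LFunctions

end
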